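import Literature.AnabelianGeometry.SemiGraphs.PSCUnrVerticialSeparatingCoveringsTwoComponentAffine
import Literature.GroupTheory.CombinatorialGroupTheory.PuncturedSurfaceGroupTwoNodeCycleUnrQuotient
import HarnessLib

/-!
# [CombGC] Prop. 1.2, proof p. 9: the `Π^unr`-VERTICIAL separating coverings at the TWO-NODE-CYCLE shape (row F-2828)

Mochizuki, *A combinatorial version of the Grothendieck conjecture*, Tohoku Math. J. **59** (2007)
[CombGC], PROOF of Prop. 1.2, p. 9, the unramified case [cite: MochizukiCombGC2007, Prop 1.2 proof p.9];
typed level-wise as `PSCDatum.UnrVerticialSeparatingCoverings` (row P12-L01-U, the `Π^unr` conjunct of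
F-2829).  PROOF-ONLY file (abc-iut-f-164 gen 5, NEXT-SHAPES row «TWO-NODE-CYCLE»): the analogue of
abc-iut-w5-d047's `unrVerticialSeparatingCoverings_of_twoComponentAffine` (one node) at the data of
two-node-cycle shape (`PSCSeparatingCoveringsTwoNodeCycle.lean`): components `v₀` (genus `m ≥ 1`, cusps
`c_s,…`) and `v₁` (genus `g - m - 1 ≥ 1`, cusps `c_0,…,c_{s-1}`), nodes `⟨b_m⟩`, `⟨δ⟩`.  Route:
`Ker(Π ↠ Π^unr) = cl ι⟨⟨b_m, δ, c_j⟩⟩` (`PSCUnrKerOfEdgeGenerators`), the Tietze isomorphism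
`Γ/⟨⟨b_m, δ, c_j⟩⟩ ≅ Γ_{m,0} ∗ (ℤ ∗ Γ_{g-m-1,0})` (`PuncturedSurfaceGroupTwoNodeCycleUnrQuotient`, the
cycle contributes the free factor `ℤ = ⟨a_m⟩`), re-bracketed by `MulEquiv.coprodAssoc/Comm/Congr` so that
the ALIVE vertex is the left factor, and abc-iut-f-166's discrete separating levels
(`exists_normal_separating_sameFactor / _crossFactor`) transferred to open `U ⊴ V`
(`exists_open_unrSeparating_same / _cross`).  Sturdiness is not needed beyond `m, g-m-1 ≥ 1`.

* `cycle_map_mk_closure_v0_eq_range`, `cycle_map_mk_closure_v1_eq_range` — the two vertex generating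
  sets map onto the factors `Γ_{m,0}`, `Γ_{g-m-1,0}` of the unramified quotient;
* `unrVerticialSeparatingCoverings_of_twoNodeCycle` — **row F-2828 at EVERY two-node-cycle datum**.
0 definitions; nothing here takes a side on [IUTchIII] Cor. 3.12.
-/

noncomputable section

namespace Literature.AnabelianGeometry.SemiGraphs

open scoped Pointwise
open Literature.AnabelianGeometry.Anabelioids (IsSigmaInteger)
open Literature.GroupTheory.CombinatorialGroupTheory
open Monoid (Coprod)

namespace PSCDatum

open SemiGraphOfAnabelioids (IsProSigmaCompletion)
open SemiGraphOfAnabelioids.IsProSigmaCompletion (exists_open_unrSeparating_same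
  exists_open_unrSeparating_cross finiteIndex_comap)
open Literature.GroupTheory.CombinatorialGroupTheory.PuncturedSurfaceGroup (a b c cuspInertia
  exists_mulEquiv_cycleUnrQuotient_coprod exists_handleCharacter_pow_ne_one)

/-! ### The two vertex generating sets in the unramified quotient -/

section Vertex

variable {m g₁ r : ℕ} (s : ℕ) (K : Subgroup (PuncturedSurfaceGroup (m + (1 + g₁)) r)) [K.Normal]

/-- **The `v₀`-side generating set of the 2-cycle maps onto the factor `Γ_{m,0}`**: for
`η : Γ_{m,0} → Γ/K` with `η a_i = [a_{castAdd i}]`, `η b_i = [b_{castAdd i}]` and `K ∋ c_j, b_m, δ` normal,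
the image of `⟨a_i, b_i (i < m), c_j (s ≤ j), a_m b_m a_m⁻¹, δ⟩` is the range of `η`.
[cite: MochizukiCombGC2007, Def 1.1(ii) p.7] -/
theorem cycle_map_mk_closure_v0_eq_range (hcK : ∀ j, c j ∈ K)
    (hbK : b (r := r) (⟨m, by omega⟩ : Fin (m + (1 + g₁))) ∈ K) {δ : PuncturedSurfaceGroup (m + (1 + g₁)) r}
    (hδK : δ ∈ K) (η : PuncturedSurfaceGroup m 0 →* _ ⧸ K)
    (hpin : ∀ (i : Fin m) (bit : Bool), η (PresentedGroup.of (Sum.inl (i, bit))) =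
      QuotientGroup.mk (PresentedGroup.of (Sum.inl (Fin.castAdd (1 + g₁) i, bit)))) :
    (Subgroup.closure {x : PuncturedSurfaceGroup (m + (1 + g₁)) r |
        (∃ i : Fin (m + (1 + g₁)), (i : ℕ) < m ∧ (x = a i ∨ x = b i)) ∨
          (∃ j : Fin r, s ≤ (j : ℕ) ∧ x = c j) ∨
          x = a (⟨m, by omega⟩ : Fin (m + (1 + g₁))) * b ⟨m, by omega⟩ * (a ⟨m, by omega⟩)⁻¹ ∨
          x = δ}).map (QuotientGroup.mk' K) = η.range := by
  rw [MonoidHom.range_eq_map, ← PresentedGroup.closure_range_of, MonoidHom.map_closure,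
    MonoidHom.map_closure]
  apply le_antisymm
  · refine (Subgroup.closure_le _).mpr ?_
    rintro y ⟨x, hx, rfl⟩
    rcases hx with ⟨i, hi, rfl | rfl⟩ | ⟨j, -, rfl⟩ | rfl | rfl
    · have hii : i = Fin.castAdd (1 + g₁) ⟨i, hi⟩ := Fin.ext (by simp)
      refine Subgroup.subset_closure ⟨a ⟨i, hi⟩, ⟨Sum.inl (⟨i, hi⟩, false), rfl⟩, ?_⟩
      change η (PresentedGroup.of (Sum.inl (⟨i, hi⟩, false))) = _
      rw [hpin, QuotientGroup.mk'_apply]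
      exact congrArg (fun t : Fin (m + (1 + g₁)) => (QuotientGroup.mk (PresentedGroup.of (Sum.inl (t, false))) :
        PuncturedSurfaceGroup (m + (1 + g₁)) r ⧸ K)) hii.symm
    · have hii : i = Fin.castAdd (1 + g₁) ⟨i, hi⟩ := Fin.ext (by simp)
      refine Subgroup.subset_closure ⟨b ⟨i, hi⟩, ⟨Sum.inl (⟨i, hi⟩, true), rfl⟩, ?_⟩
      change η (PresentedGroup.of (Sum.inl (⟨i, hi⟩, true))) = _
      rw [hpin, QuotientGroup.mk'_apply]
      exact congrArg (fun t : Fin (m + (1 + g₁)) => (QuotientGroup.mk (PresentedGroup.of (Sum.inl (t, true))) :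
        PuncturedSurfaceGroup (m + (1 + g₁)) r ⧸ K)) hii.symm
    · rw [QuotientGroup.mk'_apply, (QuotientGroup.eq_one_iff _).mpr (hcK j)]
      exact Subgroup.one_mem _
    · rw [map_mul, map_mul, map_inv, QuotientGroup.mk'_apply, QuotientGroup.mk'_apply,
        (QuotientGroup.eq_one_iff _).mpr hbK, mul_one, mul_inv_cancel]
      exact Subgroup.one_mem _
    · rw [QuotientGroup.mk'_apply, (QuotientGroup.eq_one_iff _).mpr hδK]
      exact Subgroup.one_mem _
  · refine (Subgroup.closure_le _).mpr ?_
    rintro y ⟨z, ⟨x, rfl⟩, rfl⟩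
    rcases x with ⟨i, bit⟩ | j
    · refine Subgroup.subset_closure ⟨PresentedGroup.of (Sum.inl (Fin.castAdd (1 + g₁) i, bit)), ?_, ?_⟩
      · refine Or.inl ⟨Fin.castAdd (1 + g₁) i, by simp, ?_⟩
        cases bit
        · exact Or.inl rfl
        · exact Or.inr rfl
      · rw [QuotientGroup.mk'_apply, ← hpin i bit]
    · exact Fin.elim0 j

/-- **The `v₁`-side generating set of the 2-cycle maps onto the factor `Γ_{g₁,0}`**: for
`η : Γ_{g₁,0} → Γ/K` with `η a_j = [a_{m+1+j}]`, `η b_j = [b_{m+1+j}]` and `K ∋ c_j, b_m, δ` normal, the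
image of `⟨a_i, b_i (m < i), c_j (j < s), b_m, δ⟩` is the range of `η`.
[cite: MochizukiCombGC2007, Def 1.1(ii) p.7] -/
theorem cycle_map_mk_closure_v1_eq_range (hcK : ∀ j, c j ∈ K)
    (hbK : b (r := r) (⟨m, by omega⟩ : Fin (m + (1 + g₁))) ∈ K) {δ : PuncturedSurfaceGroup (m + (1 + g₁)) r}
    (hδK : δ ∈ K) (η : PuncturedSurfaceGroup g₁ 0 →* _ ⧸ K)
    (hpin : ∀ (j : Fin g₁) (bit : Bool), η (PresentedGroup.of (Sum.inl (j, bit))) =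
      QuotientGroup.mk (PresentedGroup.of (Sum.inl (Fin.natAdd m (Fin.natAdd 1 j), bit)))) :
    (Subgroup.closure {x : PuncturedSurfaceGroup (m + (1 + g₁)) r |
        (∃ i : Fin (m + (1 + g₁)), m < (i : ℕ) ∧ (x = a i ∨ x = b i)) ∨
          (∃ j : Fin r, (j : ℕ) < s ∧ x = c j) ∨ x = b (⟨m, by omega⟩ : Fin (m + (1 + g₁))) ∨
          x = δ}).map (QuotientGroup.mk' K) = η.range := by
  rw [MonoidHom.range_eq_map, ← PresentedGroup.closure_range_of, MonoidHom.map_closure,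
    MonoidHom.map_closure]
  apply le_antisymm
  · refine (Subgroup.closure_le _).mpr ?_
    rintro y ⟨x, hx, rfl⟩
    rcases hx with ⟨i, hi, rfl | rfl⟩ | ⟨j, -, rfl⟩ | rfl | rfl
    · have hi' : (i : ℕ) - (m + 1) < g₁ := by omega
      have hii : i = Fin.natAdd m (Fin.natAdd 1 ⟨(i : ℕ) - (m + 1), hi'⟩) := Fin.ext (by simp; omega)
      refine Subgroup.subset_closure ⟨a ⟨(i : ℕ) - (m + 1), hi'⟩,
        ⟨Sum.inl (⟨(i : ℕ) - (m + 1), hi'⟩, false), rfl⟩, ?_⟩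
      change η (PresentedGroup.of (Sum.inl (⟨(i : ℕ) - (m + 1), hi'⟩, false))) = _
      rw [hpin, QuotientGroup.mk'_apply]
      exact congrArg (fun t : Fin (m + (1 + g₁)) => (QuotientGroup.mk (PresentedGroup.of (Sum.inl (t, false))) :
        PuncturedSurfaceGroup (m + (1 + g₁)) r ⧸ K)) hii.symm
    · have hi' : (i : ℕ) - (m + 1) < g₁ := by omega
      have hii : i = Fin.natAdd m (Fin.natAdd 1 ⟨(i : ℕ) - (m + 1), hi'⟩) := Fin.ext (by simp; omega)
      refine Subgroup.subset_closure ⟨b ⟨(i : ℕ) - (m + 1), hi'⟩,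
        ⟨Sum.inl (⟨(i : ℕ) - (m + 1), hi'⟩, true), rfl⟩, ?_⟩
      change η (PresentedGroup.of (Sum.inl (⟨(i : ℕ) - (m + 1), hi'⟩, true))) = _
      rw [hpin, QuotientGroup.mk'_apply]
      exact congrArg (fun t : Fin (m + (1 + g₁)) => (QuotientGroup.mk (PresentedGroup.of (Sum.inl (t, true))) :
        PuncturedSurfaceGroup (m + (1 + g₁)) r ⧸ K)) hii.symm
    · rw [QuotientGroup.mk'_apply, (QuotientGroup.eq_one_iff _).mpr (hcK j)]
      exact Subgroup.one_mem _
    · rw [QuotientGroup.mk'_apply, (QuotientGroup.eq_one_iff _).mpr hbK]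
      exact Subgroup.one_mem _
    · rw [QuotientGroup.mk'_apply, (QuotientGroup.eq_one_iff _).mpr hδK]
      exact Subgroup.one_mem _
  · refine (Subgroup.closure_le _).mpr ?_
    rintro y ⟨z, ⟨x, rfl⟩, rfl⟩
    rcases x with ⟨j, bit⟩ | j
    · refine Subgroup.subset_closure ⟨PresentedGroup.of (Sum.inl (Fin.natAdd m (Fin.natAdd 1 j), bit)), ?_, ?_⟩
      · refine Or.inl ⟨Fin.natAdd m (Fin.natAdd 1 j), by simp, ?_⟩
        cases bit
        · exact Or.inl rfl
        · exact Or.inr rfl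
      · rw [QuotientGroup.mk'_apply, ← hpin j bit]
    · exact Fin.elim0 j

end Vertex

/-! ### Row P12-L01-U at the two-node-cycle data -/

variable {P : Type} [Group P] [TopologicalSpace P] [IsTopologicalGroup P]
variable [CompactSpace P] [TotallyDisconnectedSpace P] {Sigma : Set ℕ} {g r : ℕ}

/-- **Row F-2828 / P12-L01-U (`UnrVerticialSeparatingCoverings`, `V' := V`) at EVERY datum of
two-node-cycle shape** (components of genera `m ≥ 1`, `g - m - 1 ≥ 1`): distinct vertices of the
`Π^unr`-covering `G_V` are separated by an open `U ≤ V`, normal in `V`, containing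
`(γ₂Π_{v₂}γ₂⁻¹ · Ker) ∩ V` and not `γ₁Π_{v₁}γ₁⁻¹ ∩ V`; witness `a^{[Γ:ι⁻¹V]}` for the first handle `a` of
the alive vertex, separated in `Γ/⟨⟨b_m, δ, c_j⟩⟩ ≅ Γ_{m,0} ∗ (ℤ ∗ Γ_{g-m-1,0})` by abc-iut-f-166's fibred
twist (same vertex) resp. the projection to the alive factor (different vertices).
[cite: MochizukiCombGC2007, Prop 1.2 proof p.9] -/
theorem unrVerticialSeparatingCoverings_of_twoNodeCycle (hne : Sigma.Nonempty)
    (hprime : ∀ p ∈ Sigma, p.Prime) (ι : PuncturedSurfaceGroup g r →* P)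
    (hι : IsProSigmaCompletion Sigma ι) (G : PSCDatum P) {m s : ℕ} (hm : m + 2 ≤ g) (hm1 : 1 ≤ m)
    (e : G.graph.C ≃ Fin r)
    (hC : ∀ c', G.cuspGp c' = ((cuspInertia (g := g) (e c')).map ι).topologicalClosure)
    (v₀ v₁ : G.graph.V) (hV : ∀ w, w = v₀ ∨ w = v₁)
    (n₁ n₂ : G.graph.N) (hn : n₁ ≠ n₂) (hN : ∀ n, n = n₁ ∨ n = n₂) (δ : PuncturedSurfaceGroup g r)
    (hδ : δ = (((List.finRange r).map fun j : Fin r =>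
        if (j : ℕ) < s then PuncturedSurfaceGroup.c (g := g) j else 1).prod)⁻¹ *
      (((List.finRange g).map fun i : Fin g => if m + 1 ≤ (i : ℕ) then
        PuncturedSurfaceGroup.a (r := r) i * PuncturedSurfaceGroup.b i *
          (PuncturedSurfaceGroup.a i)⁻¹ * (PuncturedSurfaceGroup.b i)⁻¹ else 1).prod)⁻¹ *
      PuncturedSurfaceGroup.b ⟨m, by omega⟩)
    (hV₀ : G.vertGp v₀ = ((Subgroup.closure {x : PuncturedSurfaceGroup g r |
        (∃ i : Fin g, (i : ℕ) < m ∧ (x = PuncturedSurfaceGroup.a i ∨ x = PuncturedSurfaceGroup.b i)) ∨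
        (∃ j : Fin r, s ≤ (j : ℕ) ∧ x = PuncturedSurfaceGroup.c j) ∨
        x = PuncturedSurfaceGroup.a ⟨m, by omega⟩ * PuncturedSurfaceGroup.b ⟨m, by omega⟩ *
          (PuncturedSurfaceGroup.a ⟨m, by omega⟩)⁻¹ ∨ x = δ}).map ι).topologicalClosure)
    (hV₁ : G.vertGp v₁ = ((Subgroup.closure {x : PuncturedSurfaceGroup g r |
        (∃ i : Fin g, m < (i : ℕ) ∧ (x = PuncturedSurfaceGroup.a i ∨ x = PuncturedSurfaceGroup.b i)) ∨
        (∃ j : Fin r, (j : ℕ) < s ∧ x = PuncturedSurfaceGroup.c j) ∨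
        x = PuncturedSurfaceGroup.b ⟨m, by omega⟩ ∨ x = δ}).map ι).topologicalClosure)
    (hE₁ : G.nodeGp n₁ = ((Subgroup.zpowers (PuncturedSurfaceGroup.b (r := r) ⟨m, by omega⟩)).map
      ι).topologicalClosure)
    (hE₂ : G.nodeGp n₂ = ((Subgroup.zpowers δ).map ι).topologicalClosure) :
    G.UnrVerticialSeparatingCoverings := by
  classical
  intro _ V hVn hVo
  haveI := hVn
  obtain ⟨g₁, rfl⟩ : ∃ g₁, g = m + (1 + g₁) := ⟨g - (m + 1), by omega⟩
  have hg₁ : 1 ≤ g₁ := by omega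
  obtain ⟨ℓ, hℓS⟩ := hne
  have hℓ : ℓ.Prime := hprime ℓ hℓS
  set km : Fin (m + (1 + g₁)) := ⟨m, by omega⟩ with hkm
  set K : Subgroup (PuncturedSurfaceGroup (m + (1 + g₁)) r) :=
    Subgroup.normalClosure ({b km, δ} ∪ Set.range (c : Fin r → PuncturedSurfaceGroup (m + (1 + g₁)) r))
    with hKdef
  have hcK : ∀ j, c j ∈ K := fun j => Subgroup.subset_normalClosure (Or.inr ⟨j, rfl⟩)
  have hbK : b km ∈ K := Subgroup.subset_normalClosure (Or.inl (Or.inl rfl))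
  have hδK : δ ∈ K := Subgroup.subset_normalClosure (Or.inl (Or.inr rfl))
  -- the unramified kernel
  have hKer : G.unrKer = (K.map ι).topologicalClosure := by
    let xs : G.graph.N ⊕ G.graph.C → PuncturedSurfaceGroup (m + (1 + g₁)) r :=
      Sum.elim (fun n => if n = n₁ then b km else δ) fun c' => c (e c')
    have hx : ∀ e', G.edgeGp e' = ((Subgroup.zpowers (xs e')).map ι).topologicalClosure := by
      rintro (n | c')
      · by_cases hn1 : n = n₁
        · subst hn1
          rw [show xs (Sum.inl n) = b km from by simp [xs]]
          exact hE₁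
        · obtain rfl := (hN n).resolve_left hn1
          simp only [xs, Sum.elim_inl, if_neg hn1]
          exact hE₂
      · exact hC c'
    have hrange : Set.range xs = {b km, δ} ∪ Set.range (c : Fin r → PuncturedSurfaceGroup (m + (1 + g₁)) r) := by
      ext x
      simp only [Set.mem_range, Set.mem_union, Set.mem_insert_iff, Set.mem_singleton_iff, Sum.exists]
      constructor
      · rintro (⟨n, rfl⟩ | ⟨c', rfl⟩)
        · by_cases hn1 : n = n₁
          · exact Or.inl (Or.inl (by simp [xs, hn1]))
          · exact Or.inl (Or.inr (by simp [xs, hn1]))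
        · exact Or.inr ⟨e c', rfl⟩
      · rintro ((rfl | rfl) | ⟨j, rfl⟩)
        · exact Or.inl ⟨n₁, by simp [xs]⟩
        · exact Or.inl ⟨n₂, by simp [xs, hn.symm]⟩
        · exact Or.inr ⟨e.symm j, by simp [xs]⟩
    rw [G.unrKer_eq_topologicalClosure_map_normalClosure hι.dense xs hx, hrange]
  -- the Tietze isomorphism and its re-bracketings (alive vertex = left factor)
  obtain ⟨_, e𝔠, h1, h2, h3⟩ := exists_mulEquiv_cycleUnrQuotient_coprod m g₁ r s δ hδ
  set ē := e𝔠.symm with hēdef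
  have hēA : ∀ (i : Fin m) (bit : Bool), ē (Coprod.inl (PresentedGroup.of (Sum.inl (i, bit)))) =
      QuotientGroup.mk (PresentedGroup.of (Sum.inl (Fin.castAdd (1 + g₁) i, bit))) :=
    fun i bit => (MulEquiv.symm_apply_eq e𝔠).mpr (h1 i bit).symm
  have hēB : ∀ (j : Fin g₁) (bit : Bool), ē (Coprod.inr (Coprod.inr (PresentedGroup.of (Sum.inl (j, bit))))) =
      QuotientGroup.mk (PresentedGroup.of (Sum.inl (Fin.natAdd m (Fin.natAdd 1 j), bit))) :=
    fun j bit => (MulEquiv.symm_apply_eq e𝔠).mpr (h3 j bit).symm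
  -- alive `v₀`, killed `v₁`: `(Γ_{m,0} ∗ ℤ) ∗ Γ_{g₁,0}`
  set ē₀₁ := (MulEquiv.coprodAssoc (PuncturedSurfaceGroup m 0) (Multiplicative ℤ)
    (PuncturedSurfaceGroup g₁ 0)).trans ē with hē₀₁def
  -- `v₁ / v₁`: `Γ_{g₁,0} ∗ (Γ_{m,0} ∗ ℤ)`
  set ē₁₁ := (MulEquiv.coprodComm (PuncturedSurfaceGroup g₁ 0)
    (Coprod (PuncturedSurfaceGroup m 0) (Multiplicative ℤ))).trans ē₀₁ with hē₁₁def
  -- alive `v₁`, killed `v₀`: `(Γ_{g₁,0} ∗ ℤ) ∗ Γ_{m,0}`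
  set ē₁₀ := ((MulEquiv.coprodComm (Coprod (PuncturedSurfaceGroup g₁ 0) (Multiplicative ℤ))
    (PuncturedSurfaceGroup m 0)).trans (MulEquiv.coprodCongr (MulEquiv.refl (PuncturedSurfaceGroup m 0))
      (MulEquiv.coprodComm (PuncturedSurfaceGroup g₁ 0) (Multiplicative ℤ)))).trans ē with hē₁₀def
  have hē₀₁l : ∀ x, ē₀₁ (Coprod.inl (Coprod.inl x)) = ē (Coprod.inl x) := fun x => rfl
  have hē₀₁r : ∀ y, ē₀₁ (Coprod.inr y) = ē (Coprod.inr (Coprod.inr y)) := fun y => rfl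
  have hē₁₁l : ∀ y, ē₁₁ (Coprod.inl y) = ē (Coprod.inr (Coprod.inr y)) := fun y => rfl
  have hē₁₀l : ∀ y, ē₁₀ (Coprod.inl (Coprod.inl y)) = ē (Coprod.inr (Coprod.inr y)) := fun y => rfl
  have hē₁₀r : ∀ x, ē₁₀ (Coprod.inr x) = ē (Coprod.inl x) := fun x => rfl
  -- the two vertex generating subgroups and their images
  set H₀ : Subgroup (PuncturedSurfaceGroup (m + (1 + g₁)) r) := Subgroup.closure {x |
      (∃ i : Fin (m + (1 + g₁)), (i : ℕ) < m ∧ (x = a i ∨ x = b i)) ∨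
        (∃ j : Fin r, s ≤ (j : ℕ) ∧ x = c j) ∨ x = a km * b km * (a km)⁻¹ ∨ x = δ} with hH₀def
  set H₁ : Subgroup (PuncturedSurfaceGroup (m + (1 + g₁)) r) := Subgroup.closure {x |
      (∃ i : Fin (m + (1 + g₁)), m < (i : ℕ) ∧ (x = a i ∨ x = b i)) ∨
        (∃ j : Fin r, (j : ℕ) < s ∧ x = c j) ∨ x = b km ∨ x = δ} with hH₁def
  have hH₀ : H₀.map (QuotientGroup.mk' K) = (ē.toMonoidHom.comp Coprod.inl).range :=
    cycle_map_mk_closure_v0_eq_range s K hcK hbK hδK _ fun i bit => hēA i bit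
  have hH₁ : H₁.map (QuotientGroup.mk' K) = ((ē.toMonoidHom.comp Coprod.inr).comp Coprod.inr).range :=
    cycle_map_mk_closure_v1_eq_range s K hcK hbK hδK _ fun j bit => hēB j bit
  have hH₁' : H₁.map (QuotientGroup.mk' K) = (ē₀₁.toMonoidHom.comp Coprod.inr).range := by
    rw [hH₁]; exact congrArg MonoidHom.range (MonoidHom.ext fun y => (hē₀₁r y).symm)
  have hH₁'' : H₁.map (QuotientGroup.mk' K) = (ē₁₁.toMonoidHom.comp Coprod.inl).range := by
    rw [hH₁]; exact congrArg MonoidHom.range (MonoidHom.ext fun y => (hē₁₁l y).symm)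
  have hH₀' : H₀.map (QuotientGroup.mk' K) = (ē₁₀.toMonoidHom.comp Coprod.inr).range := by
    rw [hH₀]; exact congrArg MonoidHom.range (MonoidHom.ext fun x => (hē₁₀r x).symm)
  -- the level `N = ι⁻¹(V)`, `n = [Γ : N]`, the modulus `ℓ^n ∤ n`
  haveI hNfi : (V.comap ι).FiniteIndex := finiteIndex_comap hι V hVo
  have hidx0 : 0 < (V.comap ι).index := Nat.pos_of_ne_zero Subgroup.FiniteIndex.index_ne_zero
  haveI : NeZero (ℓ ^ (V.comap ι).index) := ⟨(pow_pos hℓ.pos _).ne'⟩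
  have hnm : ¬ ℓ ^ (V.comap ι).index ∣ (V.comap ι).index := fun h =>
    absurd (Nat.le_of_dvd hidx0 h) (not_le.mpr (Nat.lt_pow_self hℓ.one_lt))
  -- witnesses
  obtain ⟨ψ₀, hψ₀, hcard⟩ := exists_handleCharacter_pow_ne_one (g := m) (by omega) (V.comap ι).index
    (ℓ ^ (V.comap ι).index) hnm
  obtain ⟨ψ₁, hψ₁, -⟩ := exists_handleCharacter_pow_ne_one (g := g₁) (by omega) (V.comap ι).index
    (ℓ ^ (V.comap ι).index) hnm
  have ha₀N : a (r := r) (Fin.castAdd (1 + g₁) ⟨0, by omega⟩) ^ (V.comap ι).index ∈ V.comap ι :=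
    (V.comap ι).pow_index_mem _
  have ha₁N : a (r := r) (Fin.natAdd m (Fin.natAdd 1 ⟨0, by omega⟩)) ^ (V.comap ι).index ∈ V.comap ι :=
    (V.comap ι).pow_index_mem _
  have ha₀H : a (r := r) (Fin.castAdd (1 + g₁) ⟨0, by omega⟩) ^ (V.comap ι).index ∈ H₀ :=
    H₀.pow_mem (Subgroup.subset_closure (Or.inl ⟨Fin.castAdd (1 + g₁) ⟨0, by omega⟩, by simp; omega,
      Or.inl rfl⟩)) _
  have ha₁H : a (r := r) (Fin.natAdd m (Fin.natAdd 1 ⟨0, by omega⟩)) ^ (V.comap ι).index ∈ H₁ :=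
    H₁.pow_mem (Subgroup.subset_closure (Or.inl ⟨Fin.natAdd m (Fin.natAdd 1 ⟨0, by omega⟩), by simp,
      Or.inl rfl⟩)) _
  have hα₀ : QuotientGroup.mk' K (a (r := r) (Fin.castAdd (1 + g₁) ⟨0, by omega⟩) ^ (V.comap ι).index) =
      ē (Coprod.inl (a ⟨0, by omega⟩ ^ (V.comap ι).index)) := by
    rw [map_pow, map_pow, map_pow, QuotientGroup.mk'_apply]
    exact congrArg (· ^ (V.comap ι).index) (hēA ⟨0, by omega⟩ false).symm
  have hα₁ : QuotientGroup.mk' K (a (r := r) (Fin.natAdd m (Fin.natAdd 1 ⟨0, by omega⟩)) ^ (V.comap ι).index) =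
      ē (Coprod.inr (Coprod.inr (a ⟨0, by omega⟩ ^ (V.comap ι).index))) := by
    rw [map_pow, map_pow, map_pow, map_pow, QuotientGroup.mk'_apply]
    exact congrArg (· ^ (V.comap ι).index) (hēB ⟨0, by omega⟩ false).symm
  have hα₀' : QuotientGroup.mk' K (a (r := r) (Fin.castAdd (1 + g₁) ⟨0, by omega⟩) ^ (V.comap ι).index) =
      ē₀₁ (Coprod.inl (Coprod.inl (a ⟨0, by omega⟩ ^ (V.comap ι).index))) := by
    rw [hē₀₁l]; exact hα₀
  have hα₁' : QuotientGroup.mk' K (a (r := r) (Fin.natAdd m (Fin.natAdd 1 ⟨0, by omega⟩)) ^ (V.comap ι).index) =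
      ē₁₁ (Coprod.inl (a ⟨0, by omega⟩ ^ (V.comap ι).index)) := by
    rw [hē₁₁l]; exact hα₁
  have hα₁'' : QuotientGroup.mk' K (a (r := r) (Fin.natAdd m (Fin.natAdd 1 ⟨0, by omega⟩)) ^ (V.comap ι).index) =
      ē₁₀ (Coprod.inl (Coprod.inl (a ⟨0, by omega⟩ ^ (V.comap ι).index))) := by
    rw [hē₁₀l]; exact hα₁
  have hψ₀' : (ψ₀.comp (Coprod.fst : Coprod (PuncturedSurfaceGroup m 0) (Multiplicative ℤ) →*
      PuncturedSurfaceGroup m 0)) (Coprod.inl (a ⟨0, by omega⟩ ^ (V.comap ι).index)) ≠ 1 := by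
    rw [MonoidHom.comp_apply, Coprod.fst_apply_inl]; exact hψ₀
  have hψ₁' : (ψ₁.comp (Coprod.fst : Coprod (PuncturedSurfaceGroup g₁ 0) (Multiplicative ℤ) →*
      PuncturedSurfaceGroup g₁ 0)) (Coprod.inl (a ⟨0, by omega⟩ ^ (V.comap ι).index)) ≠ 1 := by
    rw [MonoidHom.comp_apply, Coprod.fst_apply_inl]; exact hψ₁
  -- bookkeeping shared by the four cases
  have hS : ∀ U' : Subgroup (V.comap ι), U'.index ∣ Nat.card (Multiplicative (ZMod (ℓ ^ (V.comap ι).index))) →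
      U'.FiniteIndex → IsSigmaInteger Sigma U'.index := fun U' h hf =>
    ⟨Nat.pos_of_ne_zero hf.index_ne_zero, fun _ hp hpn =>
      ((Nat.prime_dvd_prime_iff_eq hp hℓ).mp (hp.dvd_of_dvd_pow (hpn.trans (hcard ▸ h)))) ▸ hℓS⟩
  have hwit : ∀ (f : PuncturedSurfaceGroup (m + (1 + g₁)) r) (H : Subgroup (PuncturedSurfaceGroup (m + (1 + g₁)) r))
      (x : PuncturedSurfaceGroup (m + (1 + g₁)) r), x ∈ H → x ∈ V.comap ι →
      f * x * f⁻¹ ∈ (ConjAct.toConjAct f • H) ⊓ V.comap ι := fun f H x hx hxN => by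
    refine ⟨?_, (inferInstance : (V.comap ι).Normal).conj_mem x hxN f⟩
    have hfx : f * x * f⁻¹ = ConjAct.toConjAct f • x := by
      rw [ConjAct.smul_def, ConjAct.ofConjAct_toConjAct]
    rw [hfx]
    exact Subgroup.smul_mem_pointwise_smul _ _ _ hx
  refine ⟨V, hVn, hVo, le_rfl, fun w₁ w₂ γ₁ γ₂ hdc => ?_⟩
  rcases hV w₁ with rfl | rfl <;> rcases hV w₂ with rfl | rfl
  · -- `v₀ / v₀`: same factor, `ē`
    refine exists_open_unrSeparating_same hι H₀ K _ _ hV₀ hKer V hVo γ₁ γ₂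
      (hdc.resolve_left fun h => h rfl) fun f₁ f₂ hf => ?_
    obtain ⟨U', hU'n, hidx, hfi, hnot, hle⟩ :=
      exists_normal_separating_sameFactor K ē H₀ hH₀ (V.comap ι) ψ₀ ha₀N hα₀ hψ₀ hf
    exact ⟨U', hU'n, hS U' hidx hfi, hle, _, hwit f₁ H₀ _ ha₀H ha₀N, hnot⟩
  · -- alive `v₀`, killed `v₁`: projection to the factor `Γ_{m,0} ∗ ℤ` of `ē₀₁`, then to `Γ_{m,0}`
    refine exists_open_unrSeparating_cross hι H₀ H₁ K _ _ _ hV₀ hV₁ hKer V hVo γ₁ γ₂ fun f₁ f₂ => ?_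
    obtain ⟨U', hU'n, hidx, hfi, hnot, hle⟩ :=
      exists_normal_separating_crossFactor K ē₀₁ H₁ hH₁' (V.comap ι) _ hα₀' hψ₀' f₁ f₂
    exact ⟨U', hU'n, hS U' hidx hfi, hle, _, hwit f₁ H₀ _ ha₀H ha₀N, hnot⟩
  · -- alive `v₁`, killed `v₀`: `ē₁₀`
    refine exists_open_unrSeparating_cross hι H₁ H₀ K _ _ _ hV₁ hV₀ hKer V hVo γ₁ γ₂ fun f₁ f₂ => ?_
    obtain ⟨U', hU'n, hidx, hfi, hnot, hle⟩ :=
      exists_normal_separating_crossFactor K ē₁₀ H₀ hH₀' (V.comap ι) _ hα₁'' hψ₁' f₁ f₂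
    exact ⟨U', hU'n, hS U' hidx hfi, hle, _, hwit f₁ H₁ _ ha₁H ha₁N, hnot⟩
  · -- `v₁ / v₁`: same factor, `ē₁₁`
    refine exists_open_unrSeparating_same hι H₁ K _ _ hV₁ hKer V hVo γ₁ γ₂
      (hdc.resolve_left fun h => h rfl) fun f₁ f₂ hf => ?_
    obtain ⟨U', hU'n, hidx, hfi, hnot, hle⟩ :=
      exists_normal_separating_sameFactor K ē₁₁ H₁ hH₁'' (V.comap ι) ψ₁ ha₁N hα₁' hψ₁ hf
    exact ⟨U', hU'n, hS U' hidx hfi, hle, _, hwit f₁ H₁ _ ha₁H ha₁N, hnot⟩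

end PSCDatum

end Literature.AnabelianGeometry.SemiGraphs

end
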